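import Mathlib
import Summits.ResolutionOfSingularities.ResolutionOfSingularities.Theorems.WeightedInvariantLocalWeightedDropNCResBadDirPoint
import Summits.ResolutionOfSingularities.ResolutionOfSingularities.Theorems.WeightedInvariantLocalWeightedDropNCResCurveGraphDefs
import Summits.ResolutionOfSingularities.ResolutionOfSingularities.Theorems.WeightedInvariantLocalWeightedDropNCResSettingHeadDropCurve
import Summits.ResolutionOfSingularities.ResolutionOfSingularities.Theorems.WeightedInvariantLocalWeightedDropTOT2NearCurve

/-!
# `WeightedInvariant.LocalWeightedDrop`: the TOT₂ line, regime (B) «letters in bad position» — THE CURVE MOVE along a permissible letter axis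

Crux item stmt-ResolutionOfSingularities-8899 `LocalWeightedDrop` (route `ResolutionOfSingularities/WeightedInvariant`), ENGINE skeleton v33
(res-L1-w43-lead-1 g5, TOT2-LINE v1.3 §1–§3 (B)), registered regime stub `stub_regimeBad` (deal → res-type-056).  [OURS · L1 W4.3 · chain w43 · seat
res-type-056; def-free; the count game is the programme's own; nothing here is a statement of any manuscript; AI-produced, gate-checked, weaker than
expert review.]

WHAT.  Three letters, an admissibly decorated state `(b, δ)` with `o ≥ 2`, empty history, a directrix form `ℓ` supported on boundary letters with
support `S = {l ≠ j}` of size two, and `f ∈ (x_l : l ≠ j)^o` (`GraphCurve.InOffIdeal j o f`: the axis `C = ⋂_{l ≠ j} V(x_l)`, an intersection of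
two boundary components, is PERMISSIBLE).  THE DIRECTOR WINS TO «head drop, or same head in the apex column or in good position» IN ONE CURVE MOVE
`(X, 𝟙_{l ≠ j})` (`dWinsTo_exit_of_badDir_inOffIdeal`): the move is B-permissible (res-L1-w43-stub-1's `isBPermissible_of_totalO_weightedOrder` +
`GraphCurve.le_weightedOrder_of_inOffIdeal`); NEAR POINTS OVER `C` EXIST (apex dimension two — contrast `dWinsTo_headDrop_of_inAxisIdeal` at apex
dimension `≤ 1`), but at a same-head answer `c` (a normal direction of `C`, `c_j = 0`) the answer lies in the directrix plane (`ℓ · c = 0`, from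
res-L1-w43-stub-3's `TOT2Near.initEval_add_smul_eq_of_near_curve`), so BOTH support letters leave (`c_l ≠ 0` on `S`), and for the support letter
`l ≠ i` (`i` the slot) the new coordinate `y_l` is not a boundary letter while the coefficient of `y_l^o` in the new equation is the coefficient of
`x_l^o` in `f` (`coeff_single_strict_curve`, from `TOT2Near.taylorSum_eq_coeff_slice_w`), non-zero (`ℓ_l ≠ 0`): any directrix form of the
transform involves `y_l` — GOOD POSITION (or the transform is in the apex column).
-/

set_option linter.dupNamespace false -- mandated namespace of this single-conjunct summit

noncomputable section

namespace Summit.ResolutionOfSingularities.ResolutionOfSingularities.Theorems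

namespace TameFourTupleDrop

namespace NCResBad

open MvPowerSeries Literature.AlgebraicGeometry.Resolution GraphCurve TOT2E1

variable {k : Type} [Field k] {m : ℕ}

/-! ## The coefficient of a pure power through a curve chart -/

/-- `single p⁺ n = cons 0 (single p n)`. -/
theorem single_succ_eq_cons (p : Fin m) (n : ℕ) :
    (Finsupp.single p.succ n : Fin (m + 1) →₀ ℕ) = Finsupp.cons 0 (Finsupp.single p n) := by
  ext q
  refine Fin.cases ?_ (fun q' => ?_) q
  · rw [Finsupp.cons_zero, Finsupp.single_apply, if_neg (Fin.succ_ne_zero p)]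
  · rw [Finsupp.cons_succ, Finsupp.single_apply, Finsupp.single_apply]
    simp only [Fin.succ_inj]

/-- **A CHART WITH `c_l = 0` OFF THE SLOT DIRECTION READS THE PURE POWER `x_l^o`**: for a move `(X, w)` with `w ≤ 1`, an answer `c`
(`c = 0` on the weight-`0` letters), a live slot `i`, and a letter `l = i.succAbove p` of weight `1`, if `o ≤ weightedOrder_w f` and
`f(chart) = s^o · G`, then the coefficient of `y_{p⁺}^o` in `G|_{y_i = 0}` is the coefficient of `x_l^o` in `f`. -/
theorem coeff_single_slice_chart (w : Fin (m + 1) → ℕ) (c : Fin (m + 1) → k) (hw : ∀ l, w l ≤ 1) (hc0 : ∀ l, w l = 0 → c l = 0)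
    (i : Fin (m + 1)) (f : MvPowerSeries (Fin (m + 1)) k) {o : ℕ} (hperm : (o : ℕ∞) ≤ f.weightedOrder w)
    {G : MvPowerSeries (Fin (m + 1 + 1)) k} (hfac : subst (CobordantChart.chart w c) f = X 0 ^ o * G) (p : Fin m)
    (hwl : w (i.succAbove p) = 1) :
    coeff (Finsupp.single p.succ o) (TupleGame.slice i G) = coeff (Finsupp.single (i.succAbove p) o) f := by
  classical
  set l := i.succAbove p with hl
  have hli : l ≠ i := Fin.succAbove_ne i p
  -- the Hasse–Taylor sum for `β := o · e_l`
  set β : Fin (m + 1) →₀ ℕ := Finsupp.single l o with hβ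
  have hβi : β i = 0 := by rw [hβ, Finsupp.single_apply, if_neg hli]
  have hβw : ∀ l', w l' = 0 → β l' = 0 := fun l' hl' => by
    rw [hβ, Finsupp.single_apply]
    split_ifs with h
    · rw [← h, hwl] at hl'
      exact absurd hl' one_ne_zero
    · rfl
  have h := TOT2Near.taylorSum_eq_coeff_slice_w w c hw hc0 i f hperm β hβi hβw
  have hβ' : (Finsupp.equivFunOnFinite.symm fun q => β (i.succAbove q) : Fin m →₀ ℕ) = Finsupp.single p o := by
    ext q
    rw [Finsupp.coe_equivFunOnFinite_symm, hβ, Finsupp.single_apply, Finsupp.single_apply]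
    simp only [hl, Fin.succAbove_right_inj]
  rw [hβ'] at h
  -- pass from the full chart transform to `G`
  have hslice : TupleGame.slice i (subst (CobordantChart.chart w c) f) = X 0 ^ o * TupleGame.slice i G := by
    rw [hfac, MultiplicityLift.slice_X_zero_pow_mul]
  rw [single_succ_eq_cons, CobordantChart.coeff_cons_of_eq_X_pow_mul hslice, add_zero, ← h, Finset.sum_eq_single β]
  · rw [Finset.prod_eq_single l]
    · rw [hβ, Finsupp.single_eq_same, Nat.choose_self, Nat.cast_one, one_mul, Nat.sub_self, pow_zero, mul_one]
    · intro l' _ hl'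
      rw [hβ, Finsupp.single_apply, if_neg (Ne.symm hl'), Nat.choose_zero_right, Nat.cast_one, one_mul, Nat.sub_zero, pow_zero]
    · intro h; exact absurd (Finset.mem_univ l) h
  · -- other exponents of degree `o`: `e_l < o`, so `choose e_l o = 0`
    intro e he hne
    rw [Finset.mem_finsuppAntidiag] at he
    have hel : e l < o := by
      by_contra hge
      push Not at hge
      apply hne
      -- `e ≥ o · e_l` with `|e| = o` forces `e = o · e_l`
      have hsum : ∑ l', e l' = o := he.1
      rw [← Finset.add_sum_erase _ _ (Finset.mem_univ l)] at hsum
      have hrest : ∑ x ∈ Finset.univ.erase l, e x = 0 := by omega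
      have hel' : e l = o := by omega
      ext l'
      by_cases hl'l : l' = l
      · rw [hl'l, hel', hβ, Finsupp.single_eq_same]
      · rw [hβ, Finsupp.single_apply, if_neg (Ne.symm hl'l)]
        exact Finset.sum_eq_zero_iff.mp hrest l' (Finset.mem_erase.mpr ⟨hl'l, Finset.mem_univ l'⟩)
    refine mul_eq_zero_of_right _ (Finset.prod_eq_zero (Finset.mem_univ l) ?_)
    rw [hβ, Finsupp.single_eq_same, Nat.choose_eq_zero_of_lt hel, Nat.cast_zero, zero_mul]
  · intro hβmem
    refine absurd (Finset.mem_finsuppAntidiag.mpr ⟨?_, Finset.subset_univ _⟩) hβmem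
    rw [Finset.sum_eq_single l (fun l' _ hl' => by rw [hβ, Finsupp.single_apply, if_neg (Ne.symm hl')])
      (fun h => absurd (Finset.mem_univ l) h), hβ, Finsupp.single_eq_same]

/-! ## The curve move -/

/-- **REGIME (B), THE PERMISSIBLE-AXIS CASE: ONE CURVE MOVE EXITS.**  Three letters, `k` infinite.  From an admissibly decorated state with
`o ≥ 2`, empty history, a directrix form `ℓ` vanishing exactly at the letter `j`, and `f ∈ (x_l : l ≠ j)^o`, the
director wins to «admissibly decorated, and: head drop, or same head with apex column or good position» by the single curve move
`(X, 𝟙_{l ≠ j})`. -/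
theorem dWinsTo_exit_of_badDir_inOffIdeal [Infinite k] {b : MvPowerSeries (Fin (2 + 1)) k} {δ : Decoration k 2} (hadm : Admissible b δ)
    (ho : 2 ≤ δ.o) (hO : δ.O = ∅) {ℓ : Fin (2 + 1) → k} (hℓ : δ.IsDirForm ℓ) {j : Fin (2 + 1)}
    (hj0 : ℓ j = 0) (hne : ∀ l, l ≠ j → ℓ l ≠ 0) (hin : InOffIdeal j δ.o δ.f) :
    DWinsTo (St := MvPowerSeries (Fin (2 + 1)) k × Decoration k 2) Prod.fst
      (fun τ => Admissible τ.1 τ.2 ∧ (τ.2.head < δ.head ∨ (τ.2.head = δ.head ∧ (τ.2.HCol ∨ τ.2.GoodDir)))) (b, δ) := by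
  classical
  have hf : δ.f ≠ 0 := hadm.2.1.ne_zero
  have hc_eq : δ.c = δ.o := by rw [Decoration.c, hO, Finset.card_empty, add_zero]
  have hg : δ.f * ∏ l ∈ δ.O, X l = δ.f := by rw [hO, Finset.prod_empty, mul_one]
  -- the move `(X, 𝟙_{l ≠ j})`
  set w : Fin (2 + 1) → ℕ := fun l => if l = j then 0 else 1 with hw
  have hw1 : ∀ l, w l ≤ 1 := fun l => by simp only [hw]; split_ifs <;> simp
  have hwj : w j = 0 := by simp only [hw, if_true]
  have hwl : ∀ l, l ≠ j → w l = 1 := fun l hl => by simp only [hw, if_neg hl]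
  have hmv : IsCountMove (fun l => (X l : MvPowerSeries (Fin (2 + 1)) k)) w :=
    ⟨fun l => constantCoeff_X l, TupleMonomialPhase.isUnit_det_X, hw1,
      ⟨j.succAbove 0, by rw [hwl _ (Fin.succAbove_ne j 0)]; exact Nat.one_pos⟩⟩
  have hP3 : ∀ l ∈ δ.E, ∃ (l' : Fin (2 + 1)) (u : MvPowerSeries (Fin (2 + 1)) k), constantCoeff u ≠ 0 ∧
      (fun l => (X l : MvPowerSeries (Fin (2 + 1)) k)) l = u * X l' :=
    fun l _ => ⟨l, 1, by rw [map_one]; exact one_ne_zero, by rw [one_mul]⟩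
  have hpermw : ((δ.o : ℕ) : ℕ∞) ≤ δ.f.weightedOrder w := le_weightedOrder_of_inOffIdeal hin
  have hP1g : ((δ.c : ℕ) : ℕ∞) ≤ (subst (fun l => (X l : MvPowerSeries (Fin (2 + 1)) k)) (δ.f * ∏ l ∈ δ.O, X l)).weightedOrder w := by
    rw [hg, subst_X_fun, hc_eq]; exact hpermw
  have hperm : IsBPermissible δ (fun l => (X l : MvPowerSeries (Fin (2 + 1)) k)) w :=
    isBPermissible_of_totalO_weightedOrder hadm hmv hP3 hP1g
  -- one move: every answer exits
  refine DWinsTo.of_measure {σ | σ = (b, δ)} (fun _ => 0) ?_ rfl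
  rintro τ hτ -
  rw [Set.mem_setOf_eq] at hτ
  subst hτ
  refine ⟨fun l => X l, w, hmv, ?_⟩
  intro c hc hc0 A G hfac hG
  have hcj : c j = 0 := hc j hwj
  obtain ⟨i, hci⟩ : ∃ i, c i ≠ 0 := Function.ne_iff.mp hc0
  have hij : i ≠ j := fun h => hci (h ▸ hcj)
  set δ' := δ.transform (fun l => (X l : MvPowerSeries (Fin (2 + 1)) k)) w c i with hδ'
  have hadm' : Admissible (X 0 * TupleGame.slice i G) δ' := admissible_transform hadm hperm hc hfac hG hci
  have hhead' : δ'.head ≤ δ.head := Decoration.head_transform_le hperm hc hf hci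
  refine ⟨i, hci, (X 0 * TupleGame.slice i G, δ'), rfl, Or.inl ⟨hadm', ?_⟩⟩
  dsimp only
  by_cases hlt : δ'.head < δ.head
  · exact Or.inl hlt
  have heq : δ'.head = δ.head := le_antisymm hhead' (not_lt.mp hlt)
  have hO' : δ'.O = ∅ := Decoration.transform_O_eq_empty_of_head_eq hO heq
  have ho' : δ'.o = δ.o := Decoration.o_transform_of_head_eq heq
  have hc' : δ'.c = δ.c := Decoration.c_transform_of_head_eq heq
  refine Or.inr ⟨heq, ?_⟩
  by_cases hH : δ'.HCol
  · exact Or.inl hH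
  obtain ⟨ℓ', hℓ'⟩ := Decoration.exists_isDirForm_of_not_hCol hadm' (by rw [ho']; exact ho) hH
  -- the chart transform of `f` and the new equation
  set Gf := satPart (δ.fChart (fun l => (X l : MvPowerSeries (Fin (2 + 1)) k)) w c) with hGf
  have hfacf : subst (CobordantChart.chart w c) δ.f = X 0 ^ δ.o * Gf := by
    obtain ⟨hfacw, -⟩ := Decoration.fChart_eq (δ := δ) (c := c) hmv hc hf
    rw [subst_X_fun, Decoration.satExp_fChart_eq_o hperm hc hf] at hfacw
    exact hfacw
  have hf' : δ'.f = TupleGame.slice i Gf := by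
    rw [hδ', Decoration.transform_f_eq_strict_of_o_transform_eq hperm hc hf hci ho']
    unfold Decoration.strict
    rfl
  -- near: the answer is an invariance vector, hence in the directrix plane
  have hnear : ((δ.o : ℕ) : ℕ∞) ≤ (TupleGame.slice i Gf).order := by
    have h := Decoration.order_totalO hadm'
    rw [hO', Finset.prod_empty, mul_one, hf', hc', hc_eq] at h
    exact h.ge
  have hinv : δ.IsInv c := by
    intro v
    rw [hg, hc_eq]
    have h := TOT2Near.initEval_add_smul_eq_of_near_curve w c hw1 hc i hci δ.f hpermw hfacf hnear 1 v
    rwa [one_smul] at h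
  have hdot : dotProduct ℓ c = 0 := hℓ.dotProduct_eq_zero_of_isInv (by rw [hc_eq]; omega) hinv
  -- both support letters leave: some `l ≠ i` with `ℓ_l ≠ 0 ≠ c_l`
  obtain ⟨l, hli, hℓl, hcl⟩ : ∃ l, l ≠ i ∧ ℓ l ≠ 0 ∧ c l ≠ 0 := by
    by_contra hnone
    push Not at hnone
    rw [dotProduct_eq_single_term hnone] at hdot
    exact (mul_ne_zero (hne i hij) hci) hdot
  have hlj : l ≠ j := fun h => hℓl (h ▸ hj0)
  obtain ⟨p, rfl⟩ := Fin.exists_succAbove_eq hli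
  -- the new coordinate `y_{p⁺}` is not a boundary letter, and `ℓ′_{p⁺} ≠ 0`
  have hnot : p.succ ∉ δ'.E := fun h => hcl ((Decoration.succ_mem_transform_E_iff δ w hci p).mp h).2
  have hcoeff : coeff (Finsupp.single p.succ δ.o) (TupleGame.slice i Gf) = coeff (Finsupp.single (i.succAbove p) δ.o) δ.f :=
    coeff_single_slice_chart w c hw1 hc i δ.f hpermw hfacf p (hwl _ hlj)
  have hℓ'p : ℓ' p.succ ≠ 0 := by
    intro h0
    have hcδ' : δ'.c ≠ 0 := by rw [hc', hc_eq]; omega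
    have h1 := (hℓ'.apply_eq_zero_iff_coeff hcδ' p.succ).mp h0
    rw [hO', Finset.prod_empty, mul_one, hf', hc', hc_eq, hcoeff] at h1
    have h2 : ℓ (i.succAbove p) = 0 := by
      rw [hℓ.apply_eq_zero_iff_coeff (by rw [hc_eq]; omega), hg, hc_eq]
      exact h1
    exact hℓl h2
  exact Or.inr ⟨hO', ℓ', hℓ', p.succ, hnot, hℓ'p⟩

end NCResBad

end TameFourTupleDrop

end Summit.ResolutionOfSingularities.ResolutionOfSingularities.Theorems

end
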